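import Mathlib
import Summits.KontsevichZagierPeriods.KontsevichZagierPeriods.Theorems.SoloInformedLengthFacesAtan
import HarnessLib
import HarnessLib.Audit

/-!
# Block products are products in the formal period ring (Lemma K, kernel)

Solo-informed programme on `KontsevichZagierPeriods`, session s20, fourth file.

For cube polynomials `q₁ ∈ ℚ[x₀,…,x_{a−1}]`, `q₂ ∈ ℚ[x_a,…,x_{a+b−1}]`, both `≥ 1` on their unit
cubes, the subgraph solids `E_q = {(x,t) : 0 ≤ t·q(x) ≤ 1} ⊂ [0,1]^{·+1}` satisfy, in the formal
period ring `P = FormalRep ⧸ relations`,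

  `⟦[E_{q₁}]⟧ · ⟦[E_{q₂}]⟧ = ⟦[E_{q₁ ⊠ q₂}]⟧`          (`soloInformed_toFormalPeriod_blockRep`),

where `q₁ ⊠ q₂` is the block product (`soloInformedBlockMul`). Proof inside the KZ calculus: one
Newton–Leibniz move per factor, `[E_q, 1] ∼ [[0,1]ⁿ, 1/q]` (`soloInformed_subgraphRep_equivalent`),
the Fubini product rule of `P` (`toFormalPeriod_of_mul_of`), the identity of representations
`[[0,1]^a, 1/q₁] × [[0,1]^b, 1/q₂] = [[0,1]^{a+b}, 1/(q₁ ⊠ q₂)]` (`soloInformed_recipRep_prod`), and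
one Newton–Leibniz move back. Consequences: `⟦Λ_{a+b}⟧ = ⟦Λ_a⟧⟦Λ_b⟧`, `⟦Λ_{n+1}⟧ = ⟦Λ₁⟧^{n+1}`
for the log cubes, `⟦A_{n+1}⟧ = ⟦A₁⟧^{n+1}` for the arctangent solids, and the MONOMIAL form of
the seven length faces of `SoloInformedLengthFaces(Atan).lean`: e.g.
`NoLocRel(E_η(3), Λ₃) ↔ ∀ N a b ≥ 1, ỹ^N (a·x̃₃ − b·ℓ̃³) ≠ 0` with `ỹ = ⟦[π]⟧`, `x̃₃ = ⟦E_η(3)⟧`,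
`ℓ̃ = ⟦Λ₁⟧` (`vol Λ₁ = log 2`). This makes "Lemma K" of the accompanying paper (§3quater.3) a
kernel fact: the faces are literally statements about monomials in `⟦[π]⟧, ⟦E_η(n)⟧, ⟦Λ₁⟧, ⟦A₁⟧`.
-/

noncomputable section

open MeasureTheory Set Filter
open scoped Topology

namespace Summit.KontsevichZagierPeriods.KontsevichZagierPeriods.Theorems

open Literature.NumberTheory.Transcendental Literature.NumberTheory.Transcendental.KZ

variable {a b n : ℕ}

/-! ### Lemma K -/

/-- **`[[0,1]^a, 1/q₁] × [[0,1]^b, 1/q₂] = [[0,1]^{a+b}, 1/(q₁ ⊠ q₂)]`** as representations. -/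
theorem soloInformed_recipRep_prod (q₁ : MvPolynomial (Fin a) ℚ) (q₂ : MvPolynomial (Fin b) ℚ)
    (h₁ : ∀ x ∈ KZ.cube a, (1 : ℝ) ≤ MvPolynomial.aeval x q₁)
    (h₂ : ∀ x ∈ KZ.cube b, (1 : ℝ) ≤ MvPolynomial.aeval x q₂)
    (h : ∀ x ∈ KZ.cube (a + b), (1 : ℝ) ≤ MvPolynomial.aeval x (soloInformedBlockMul q₁ q₂)) :
    (soloInformedRecipRep q₁ h₁).prod (soloInformedRecipRep q₂ h₂) =
      soloInformedRecipRep (soloInformedBlockMul q₁ q₂) h := by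
  apply IntegralRep.ext'
  · ext z
    simp only [IntegralRep.prod_domain, IntegralRep.mem_prodDomain, soloInformedRecipRep_domain,
      KZ.mem_cube]
    constructor
    · rintro ⟨hz₁, hz₂⟩ k
      exact Fin.addCases (motive := fun k => 0 ≤ z k ∧ z k ≤ 1) hz₁ hz₂ k
    · intro hz
      exact ⟨fun i => hz _, fun j => hz _⟩
  · rw [IntegralRep.prod_integrand_eq]
    funext z
    simp only [IntegralRep.prodFun_apply, soloInformedRecipRep_integrand, soloInformed_aeval_blockMul,
      mul_inv]

/-- **Lemma K (kernel): `⟦[E_{q₁}]⟧ · ⟦[E_{q₂}]⟧ = ⟦[E_{q₁ ⊠ q₂}]⟧` in `P = FormalRep ⧸ relations`.**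
Two Newton–Leibniz moves, the Fubini product of `P`, and one Newton–Leibniz move back.
[Kontsevich–Zagier 2001, §1.2 rule (3), §4.1] -/
theorem soloInformed_toFormalPeriod_blockRep (q₁ : MvPolynomial (Fin a) ℚ)
    (q₂ : MvPolynomial (Fin b) ℚ)
    (h₁ : ∀ x ∈ KZ.cube a, (1 : ℝ) ≤ MvPolynomial.aeval x q₁)
    (h₂ : ∀ x ∈ KZ.cube b, (1 : ℝ) ≤ MvPolynomial.aeval x q₂)
    (h : ∀ x ∈ KZ.cube (a + b), (1 : ℝ) ≤ MvPolynomial.aeval x (soloInformedBlockMul q₁ q₂)) :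
    toFormalPeriod (of (soloInformedSubgraphRep q₁ h₁)) *
        toFormalPeriod (of (soloInformedSubgraphRep q₂ h₂)) =
      toFormalPeriod (of (soloInformedSubgraphRep (soloInformedBlockMul q₁ q₂) h)) := by
  rw [(soloInformed_subgraphRep_equivalent q₁ h₁).toFormalPeriod_eq,
    (soloInformed_subgraphRep_equivalent q₂ h₂).toFormalPeriod_eq,
    (soloInformed_subgraphRep_equivalent _ h).toFormalPeriod_eq, toFormalPeriod_of_mul_of,
    soloInformed_recipRep_prod q₁ q₂ h₁ h₂ h]

/-- **`[E_{q₁}] × [E_{q₂}] ∼ [E_{q₁ ⊠ q₂}]`**: the Fubini product of two subgraph solids is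
KZ-equivalent to the block solid. -/
theorem soloInformed_subgraphRep_prod_equivalent (q₁ : MvPolynomial (Fin a) ℚ)
    (q₂ : MvPolynomial (Fin b) ℚ)
    (h₁ : ∀ x ∈ KZ.cube a, (1 : ℝ) ≤ MvPolynomial.aeval x q₁)
    (h₂ : ∀ x ∈ KZ.cube b, (1 : ℝ) ≤ MvPolynomial.aeval x q₂)
    (h : ∀ x ∈ KZ.cube (a + b), (1 : ℝ) ≤ MvPolynomial.aeval x (soloInformedBlockMul q₁ q₂)) :
    Equivalent ((soloInformedSubgraphRep q₁ h₁).prod (soloInformedSubgraphRep q₂ h₂))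
      (soloInformedSubgraphRep (soloInformedBlockMul q₁ q₂) h) := by
  rw [Equivalent, ← toFormalPeriod_eq_iff, ← toFormalPeriod_of_mul_of,
    soloInformed_toFormalPeriod_blockRep q₁ q₂ h₁ h₂ h]

/-- Subgraph solids of equal polynomials are equal (the positivity witness is irrelevant). -/
theorem soloInformed_subgraphRep_congr {q q' : MvPolynomial (Fin n) ℚ} (hqq : q = q')
    (hq : ∀ x ∈ KZ.cube n, (1 : ℝ) ≤ MvPolynomial.aeval x q)
    (hq' : ∀ x ∈ KZ.cube n, (1 : ℝ) ≤ MvPolynomial.aeval x q') :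
    soloInformedSubgraphRep q hq = soloInformedSubgraphRep q' hq' := by
  subst hqq
  rfl

/-! ### Powers: log cubes and arctangent solids -/

/-- `∏_{i<a+b} (1 + xᵢ) = (∏_{i<a} (1 + xᵢ)) ⊠ (∏_{j<b} (1 + xⱼ))`. -/
theorem soloInformed_logPoly_add (a b : ℕ) :
    soloInformedLogPoly (a + b) =
      soloInformedBlockMul (soloInformedLogPoly a) (soloInformedLogPoly b) := by
  simp only [soloInformedLogPoly, soloInformedBlockMul, map_prod, map_add, map_one,
    MvPolynomial.rename_X]
  exact Fin.prod_univ_add (fun i => 1 + MvPolynomial.X i)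

/-- `∏_{i<a+b} (1 + xᵢ²) = (∏_{i<a} (1 + xᵢ²)) ⊠ (∏_{j<b} (1 + xⱼ²))`. -/
theorem soloInformed_atanPoly_add (a b : ℕ) :
    soloInformedAtanPoly (a + b) =
      soloInformedBlockMul (soloInformedAtanPoly a) (soloInformedAtanPoly b) := by
  simp only [soloInformedAtanPoly, soloInformedBlockMul, map_prod, map_add, map_one, map_pow,
    MvPolynomial.rename_X]
  exact Fin.prod_univ_add (fun i => 1 + MvPolynomial.X i ^ 2)

/-- **`⟦Λ_{a+b}⟧ = ⟦Λ_a⟧ · ⟦Λ_b⟧`** in `P`. -/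
theorem soloInformed_toFormalPeriod_logSolid_add (a b : ℕ) :
    toFormalPeriod (of (soloInformedLogSolid (a + b))) =
      toFormalPeriod (of (soloInformedLogSolid a)) * toFormalPeriod (of (soloInformedLogSolid b)) := by
  have h := soloInformed_blockMul_ge_one _ _ (soloInformed_logPoly_ge_one a)
    (soloInformed_logPoly_ge_one b)
  unfold soloInformedLogSolid
  rw [soloInformed_subgraphRep_congr (soloInformed_logPoly_add a b) (soloInformed_logPoly_ge_one _) h,
    soloInformed_toFormalPeriod_blockRep _ _ _ _ h]

/-- **`⟦Λ_{n+1}⟧ = ⟦Λ₁⟧^{n+1}`** in `P` (`vol Λ₁ = log 2`). -/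
theorem soloInformed_toFormalPeriod_logSolid_succ (n : ℕ) :
    toFormalPeriod (of (soloInformedLogSolid (n + 1))) =
      toFormalPeriod (of (soloInformedLogSolid 1)) ^ (n + 1) := by
  induction n with
  | zero => rw [zero_add, pow_one]
  | succ n ih => rw [soloInformed_toFormalPeriod_logSolid_add (n + 1) 1, ih, ← pow_succ]

/-- **`⟦A_{a+b}⟧ = ⟦A_a⟧ · ⟦A_b⟧`** in `P`. -/
theorem soloInformed_toFormalPeriod_atanSolid_add (a b : ℕ) :
    toFormalPeriod (of (soloInformedAtanSolid (a + b))) =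
      toFormalPeriod (of (soloInformedAtanSolid a)) *
        toFormalPeriod (of (soloInformedAtanSolid b)) := by
  have h := soloInformed_blockMul_ge_one _ _ (soloInformed_atanPoly_ge_one a)
    (soloInformed_atanPoly_ge_one b)
  unfold soloInformedAtanSolid
  rw [soloInformed_subgraphRep_congr (soloInformed_atanPoly_add a b) (soloInformed_atanPoly_ge_one _)
    h, soloInformed_toFormalPeriod_blockRep _ _ _ _ h]

/-- **`⟦A_{n+1}⟧ = ⟦A₁⟧^{n+1}`** in `P` (`vol A₁ = π/4`). -/
theorem soloInformed_toFormalPeriod_atanSolid_succ (n : ℕ) :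
    toFormalPeriod (of (soloInformedAtanSolid (n + 1))) =
      toFormalPeriod (of (soloInformedAtanSolid 1)) ^ (n + 1) := by
  induction n with
  | zero => rw [zero_add, pow_one]
  | succ n ih => rw [soloInformed_toFormalPeriod_atanSolid_add (n + 1) 1, ih, ← pow_succ]

/-- `⟦Λ₃⟧ = ⟦Λ₁⟧³`. -/
theorem soloInformed_toFormalPeriod_logSolid_three :
    toFormalPeriod (of (soloInformedLogSolid 3)) = toFormalPeriod (of (soloInformedLogSolid 1)) ^ 3 :=
  soloInformed_toFormalPeriod_logSolid_succ 2

/-- `⟦A₂⟧ = ⟦A₁⟧²`. -/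
theorem soloInformed_toFormalPeriod_atanSolid_two :
    toFormalPeriod (of (soloInformedAtanSolid 2)) = toFormalPeriod (of (soloInformedAtanSolid 1)) ^ 2 :=
  soloInformed_toFormalPeriod_atanSolid_succ 1

/-- `⟦A₆⟧ = ⟦A₁⟧⁶`. -/
theorem soloInformed_toFormalPeriod_atanSolid_six :
    toFormalPeriod (of (soloInformedAtanSolid 6)) = toFormalPeriod (of (soloInformedAtanSolid 1)) ^ 6 :=
  soloInformed_toFormalPeriod_atanSolid_succ 5

/-! ### The composite solids of the length faces as monomials -/

/-- `⟦E_{(1+x₀x₁)(1+x₂)}⟧ = ⟦E_η(2)⟧ · ⟦Λ₁⟧`. -/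
theorem soloInformed_toFormalPeriod_etaTwoLogSolid :
    toFormalPeriod (of soloInformedEtaTwoLogSolid) =
      toFormalPeriod (of (soloInformedEtaSolid 2)) * toFormalPeriod (of (soloInformedLogSolid 1)) :=
  (soloInformed_toFormalPeriod_blockRep _ _ (soloInformed_etaPoly_ge_one 2)
    (soloInformed_logPoly_ge_one 1) soloInformed_etaTwoLogPoly_ge_one).symm

/-- `⟦E_{(1+x₀x₁x₂)(1+x₃x₄)}⟧ = ⟦E_η(3)⟧ · ⟦E_η(2)⟧`. -/
theorem soloInformed_toFormalPeriod_etaThreeTwoSolid :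
    toFormalPeriod (of soloInformedEtaThreeTwoSolid) =
      toFormalPeriod (of (soloInformedEtaSolid 3)) * toFormalPeriod (of (soloInformedEtaSolid 2)) :=
  (soloInformed_toFormalPeriod_blockRep _ _ (soloInformed_etaPoly_ge_one 3)
    (soloInformed_etaPoly_ge_one 2) soloInformed_etaThreeTwoPoly_ge_one).symm

/-- `⟦E_{(1+x₀x₁x₂)(1+x₃x₄x₅)}⟧ = ⟦E_η(3)⟧²`. -/
theorem soloInformed_toFormalPeriod_etaThreeThreeSolid :
    toFormalPeriod (of soloInformedEtaThreeThreeSolid) =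
      toFormalPeriod (of (soloInformedEtaSolid 3)) ^ 2 := by
  rw [pow_two]
  exact (soloInformed_toFormalPeriod_blockRep _ _ (soloInformed_etaPoly_ge_one 3)
    (soloInformed_etaPoly_ge_one 3) soloInformed_etaThreeThreePoly_ge_one).symm

/-- `⟦E_{(1+x₀x₁)(1+x₂x₃)(1+x₄x₅)}⟧ = ⟦E_η(2)⟧³`. -/
theorem soloInformed_toFormalPeriod_etaTwoTwoTwoSolid :
    toFormalPeriod (of soloInformedEtaTwoTwoTwoSolid) =
      toFormalPeriod (of (soloInformedEtaSolid 2)) ^ 3 := by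
  have h₂₂ : toFormalPeriod (of (soloInformedSubgraphRep soloInformedEtaTwoTwoPoly
      soloInformed_etaTwoTwoPoly_ge_one)) =
      toFormalPeriod (of (soloInformedEtaSolid 2)) * toFormalPeriod (of (soloInformedEtaSolid 2)) :=
    (soloInformed_toFormalPeriod_blockRep _ _ (soloInformed_etaPoly_ge_one 2)
      (soloInformed_etaPoly_ge_one 2) soloInformed_etaTwoTwoPoly_ge_one).symm
  have h := (soloInformed_toFormalPeriod_blockRep _ _ soloInformed_etaTwoTwoPoly_ge_one
    (soloInformed_etaPoly_ge_one 2) soloInformed_etaTwoTwoTwoPoly_ge_one).symm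
  rw [h₂₂] at h
  rw [pow_three']
  exact h

/-- `⟦E_{(1+x₀²)(1+x₁²)(1+x₂)}⟧ = ⟦A₁⟧² · ⟦Λ₁⟧`. -/
theorem soloInformed_toFormalPeriod_atanTwoLogSolid :
    toFormalPeriod (of soloInformedAtanTwoLogSolid) =
      toFormalPeriod (of (soloInformedAtanSolid 1)) ^ 2 * toFormalPeriod (of (soloInformedLogSolid 1)) := by
  rw [← soloInformed_toFormalPeriod_atanSolid_two]
  exact (soloInformed_toFormalPeriod_blockRep _ _ (soloInformed_atanPoly_ge_one 2)
    (soloInformed_logPoly_ge_one 1) soloInformed_atanTwoLogPoly_ge_one).symm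

/-- `⟦E_{(1+x₀x₁x₂)(1+x₃²)(1+x₄²)}⟧ = ⟦E_η(3)⟧ · ⟦A₁⟧²`. -/
theorem soloInformed_toFormalPeriod_etaThreeAtanTwoSolid :
    toFormalPeriod (of soloInformedEtaThreeAtanTwoSolid) =
      toFormalPeriod (of (soloInformedEtaSolid 3)) * toFormalPeriod (of (soloInformedAtanSolid 1)) ^ 2 := by
  rw [← soloInformed_toFormalPeriod_atanSolid_two]
  exact (soloInformed_toFormalPeriod_blockRep _ _ (soloInformed_etaPoly_ge_one 3)
    (soloInformed_atanPoly_ge_one 2) soloInformed_etaThreeAtanTwoPoly_ge_one).symm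

/-! ### The seven length faces in monomial form

Notation in the docstrings: `ỹ = ⟦[π]⟧`, `x̃ₙ = ⟦E_η(n)⟧` (`vol = (1 − 2^{1−n}) ζ(n)`),
`ℓ̃ = ⟦Λ₁⟧` (`vol = log 2`), `ã = ⟦A₁⟧` (`vol = π/4`). -/

/-- **L1**: `NoLocRel(E_η(3), Λ₃) ↔ ∀ N, a, b ≥ 1, ỹ^N (a x̃₃ − b ℓ̃³) ≠ 0`. -/
theorem soloInformed_faceL1_monomial_iff :
    SoloInformedEtaThreeLogCubeNoLocRelation ↔
      ∀ N a b : ℕ, a ≠ 0 → b ≠ 0 →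
        toFormalPeriod (of piRep) ^ N *
          (a • toFormalPeriod (of (soloInformedEtaSolid 3)) -
            b • toFormalPeriod (of (soloInformedLogSolid 1)) ^ 3) ≠ 0 := by
  simp only [SoloInformedEtaThreeLogCubeNoLocRelation, map_sub, map_nsmul,
    soloInformed_toFormalPeriod_logSolid_three]

/-- **L2**: `NoLocRel(E_η(3), E_η(2) ⊠ Λ₁) ↔ ∀ N, a, b ≥ 1, ỹ^N (a x̃₃ − b x̃₂ ℓ̃) ≠ 0`. -/
theorem soloInformed_faceL2_monomial_iff :
    SoloInformedEtaThreeEtaTwoLogNoLocRelation ↔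
      ∀ N a b : ℕ, a ≠ 0 → b ≠ 0 →
        toFormalPeriod (of piRep) ^ N *
          (a • toFormalPeriod (of (soloInformedEtaSolid 3)) -
            b • (toFormalPeriod (of (soloInformedEtaSolid 2)) *
              toFormalPeriod (of (soloInformedLogSolid 1)))) ≠ 0 := by
  simp only [SoloInformedEtaThreeEtaTwoLogNoLocRelation, map_sub, map_nsmul,
    soloInformed_toFormalPeriod_etaTwoLogSolid]

/-- **L3**: `NoLocRel(E_η(5), E_η(3) ⊠ E_η(2)) ↔ ∀ N, a, b ≥ 1, ỹ^N (a x̃₅ − b x̃₃ x̃₂) ≠ 0`. -/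
theorem soloInformed_faceL3_monomial_iff :
    SoloInformedEtaFiveEtaThreeTwoNoLocRelation ↔
      ∀ N a b : ℕ, a ≠ 0 → b ≠ 0 →
        toFormalPeriod (of piRep) ^ N *
          (a • toFormalPeriod (of (soloInformedEtaSolid 5)) -
            b • (toFormalPeriod (of (soloInformedEtaSolid 3)) *
              toFormalPeriod (of (soloInformedEtaSolid 2)))) ≠ 0 := by
  simp only [SoloInformedEtaFiveEtaThreeTwoNoLocRelation, map_sub, map_nsmul,
    soloInformed_toFormalPeriod_etaThreeTwoSolid]

/-- **L4**: `NoLocRel(E_η(3) ⊠ E_η(3), E_η(2)^{⊠3}) ↔ ∀ N, a, b ≥ 1, ỹ^N (a x̃₃² − b x̃₂³) ≠ 0`. -/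
theorem soloInformed_faceL4_monomial_iff :
    SoloInformedEtaThreeSqEtaTwoCubeNoLocRelation ↔
      ∀ N a b : ℕ, a ≠ 0 → b ≠ 0 →
        toFormalPeriod (of piRep) ^ N *
          (a • toFormalPeriod (of (soloInformedEtaSolid 3)) ^ 2 -
            b • toFormalPeriod (of (soloInformedEtaSolid 2)) ^ 3) ≠ 0 := by
  simp only [SoloInformedEtaThreeSqEtaTwoCubeNoLocRelation, map_sub, map_nsmul,
    soloInformed_toFormalPeriod_etaThreeThreeSolid, soloInformed_toFormalPeriod_etaTwoTwoTwoSolid]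

/-- **L2′**: `NoLocRel(E_η(3), A₂ ⊠ Λ₁) ↔ ∀ N, a, b ≥ 1, ỹ^N (a x̃₃ − b ã² ℓ̃) ≠ 0`. -/
theorem soloInformed_faceL2'_monomial_iff :
    SoloInformedEtaThreeAtanTwoLogNoLocRelation ↔
      ∀ N a b : ℕ, a ≠ 0 → b ≠ 0 →
        toFormalPeriod (of piRep) ^ N *
          (a • toFormalPeriod (of (soloInformedEtaSolid 3)) -
            b • (toFormalPeriod (of (soloInformedAtanSolid 1)) ^ 2 *
              toFormalPeriod (of (soloInformedLogSolid 1)))) ≠ 0 := by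
  simp only [SoloInformedEtaThreeAtanTwoLogNoLocRelation, map_sub, map_nsmul,
    soloInformed_toFormalPeriod_atanTwoLogSolid]

/-- **L3′**: `NoLocRel(E_η(5), E_η(3) ⊠ A₂) ↔ ∀ N, a, b ≥ 1, ỹ^N (a x̃₅ − b x̃₃ ã²) ≠ 0`. -/
theorem soloInformed_faceL3'_monomial_iff :
    SoloInformedEtaFiveEtaThreeAtanTwoNoLocRelation ↔
      ∀ N a b : ℕ, a ≠ 0 → b ≠ 0 →
        toFormalPeriod (of piRep) ^ N *
          (a • toFormalPeriod (of (soloInformedEtaSolid 5)) -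
            b • (toFormalPeriod (of (soloInformedEtaSolid 3)) *
              toFormalPeriod (of (soloInformedAtanSolid 1)) ^ 2)) ≠ 0 := by
  simp only [SoloInformedEtaFiveEtaThreeAtanTwoNoLocRelation, map_sub, map_nsmul,
    soloInformed_toFormalPeriod_etaThreeAtanTwoSolid]

/-- **L4′**: `NoLocRel(E_η(3) ⊠ E_η(3), A₆) ↔ ∀ N, a, b ≥ 1, ỹ^N (a x̃₃² − b ã⁶) ≠ 0`. -/
theorem soloInformed_faceL4'_monomial_iff :
    SoloInformedEtaThreeSqAtanSixNoLocRelation ↔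
      ∀ N a b : ℕ, a ≠ 0 → b ≠ 0 →
        toFormalPeriod (of piRep) ^ N *
          (a • toFormalPeriod (of (soloInformedEtaSolid 3)) ^ 2 -
            b • toFormalPeriod (of (soloInformedAtanSolid 1)) ^ 6) ≠ 0 := by
  simp only [SoloInformedEtaThreeSqAtanSixNoLocRelation, map_sub, map_nsmul,
    soloInformed_toFormalPeriod_etaThreeThreeSolid, soloInformed_toFormalPeriod_atanSolid_six]

/-- **Face L1 at its rung, monomial form**: `LocRung₄ → ((∀ N, a, b ≥ 1, ỹ^N (a x̃₃ − b ℓ̃³) ≠ 0)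
↔ ζ(3)/(log 2)³ ∉ ℚ)`. -/
theorem soloInformed_locRung_four_faceL1_monomial_iff (h : SoloInformedLocVolumeRung 4) :
    (∀ N a b : ℕ, a ≠ 0 → b ≠ 0 →
        toFormalPeriod (of piRep) ^ N *
          (a • toFormalPeriod (of (soloInformedEtaSolid 3)) -
            b • toFormalPeriod (of (soloInformedLogSolid 1)) ^ 3) ≠ 0) ↔
      Irrational (zetaValue 3 / Real.log 2 ^ 3) := by
  rw [← soloInformed_faceL1_monomial_iff]
  exact soloInformed_locRung_four_faceL1_iff h

/-- **Face L4′ at its rung, monomial form**: `LocRung₇ → ((∀ N, a, b ≥ 1, ỹ^N (a x̃₃² − b ã⁶) ≠ 0)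
↔ ζ(3)²/π⁶ ∉ ℚ)`. -/
theorem soloInformed_locRung_seven_faceL4'_monomial_iff (h : SoloInformedLocVolumeRung 7) :
    (∀ N a b : ℕ, a ≠ 0 → b ≠ 0 →
        toFormalPeriod (of piRep) ^ N *
          (a • toFormalPeriod (of (soloInformedEtaSolid 3)) ^ 2 -
            b • toFormalPeriod (of (soloInformedAtanSolid 1)) ^ 6) ≠ 0) ↔
      Irrational (zetaValue 3 ^ 2 / Real.pi ^ 6) := by
  rw [← soloInformed_faceL4'_monomial_iff]
  exact soloInformed_locRung_seven_faceL4'_iff h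

end Summit.KontsevichZagierPeriods.KontsevichZagierPeriods.Theorems

end
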